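import Mathlib.LinearAlgebra.Lagrange
import Mathlib.RingTheory.PowerBasis
import Mathlib.FieldTheory.PrimitiveElement
import Mathlib.FieldTheory.Finite.Basic
import Mathlib.LinearAlgebra.Complex.FiniteDimensional
import Literature.Computability.AlgebraicComplexity.QuadraticDivisionAlgebra
import HarnessLib

/-!
# `R(K) = 2n − 1` for a simple field extension of degree `n` (BCS 1997, Cor. (17.2))

Topic `Literature/Computability/AlgebraicComplexity`. Source: P. Bürgisser, M. Clausen, M. A. Shokrollahi,
*Algebraic Complexity Theory* (Springer 1997), Ch. 17, §17.1 [BurgisserClausenShokrollahi1997], verbatim: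

* **(17.1) Proposition.** "For a division algebra `D` of dimension `n` over `k` we have
  `R(D) ≥ 2n − 1`."
* **(17.2) Corollary.** "If `K ⊇ k` is a finite simple extension of degree `n` and `|k| ≥ 2n − 2`,
  then `R(K) = 2n − 1`."  (Printed proof: `K ≃ k[X]/(p)` with `deg p = n`; multiply two polynomials
  of degree `< n` by evaluation at `2n − 2` points of `k` plus the product of the leading
  coefficients — `2n − 1` bilinear products — and reduce modulo `p`, a linear map; the lower bound
  is (17.1).)

## What is here (everything PROVED; no named facts — D-0026)

For a field `k`, a field `K` with a power basis `pb` over `k` (i.e. `K = k(θ)`, `n = pb.dim`), and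
`2n − 2` distinct nodes `α : Fin (2n − 2) → k`:
* `SimpleExtension.bilinComp pb α hα` — the printed bilinear computation of the multiplication of `K`
  of length `|Option (Fin (2n−2))| = 2n − 1` (products `a(αⱼ) b(αⱼ)` and `a_{n−1} b_{n−1}`, outputs
  the Lagrange polynomials and the nodal polynomial taken at `θ`);
* `SimpleExtension.card_ge` — every bilinear computation of the multiplication of `K` has length
  `≥ 2n − 1` ((17.1), here from (17.7) `QuadComp.card_ge_divisionAlgebra` via `L ≤ R`);
* `BCS1997_cor_17_2` — both halves together, and `SimpleExtension.mulComplexity_eq :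
  L(K) = 2n − 1` (the quadratic model agrees, by (17.7) and `L ≤ R`);
* instances: `SimpleExtension.mulComplexity_eq_of_separable` (any finite separable extension, via the
  primitive element theorem), `SimpleExtension.mulComplexity_eq_of_finite` (finite fields,
  `2n − 2 ≤ q`), `mulComplexity_complex_real : L_ℝ(ℂ) = 3`.

HONEST FRAMING. Classical (Winograd / Fiduccia–Zalcstein, 1977), as printed in BCS; nothing new.
"Simple extension of degree `n`" is rendered by a `PowerBasis k K` with `dim = n` (Mathlib), and
"`|k| ≥ 2n − 2`" by an injective `Fin (2n − 2) → k`. `R` is bilinear computations (BCS Def. (14.7),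
the tree's `BilinComp`), `L` quadratic ones (`QuadComp`, `mulComplexity`).

## References

* [BurgisserClausenShokrollahi1997] P. Bürgisser, M. Clausen, M. A. Shokrollahi, *Algebraic Complexity
  Theory*, Springer 1997, Prop. (17.1), Cor. (17.2) (p. 455), Prop. (17.7), Def. (14.7).
-/

noncomputable section

open scoped BigOperators

namespace Literature.Computability.AlgebraicComplexity

open Module Polynomial

namespace SimpleExtension

variable {k : Type*} [Field k] {K : Type*} [Field K] [Algebra k K]

/-- The coordinates of `x ∈ K` in the power basis, as the polynomial `∑_{m<n} x_m X^m` of degree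
`< n` (so that `x = (toPoly x)(θ)`). [cite: BurgisserClausenShokrollahi1997, Cor. (17.2) (proof)] -/
def toPoly (pb : PowerBasis k K) : K →ₗ[k] k[X] :=
  ∑ m : Fin pb.dim, (monomial (m : ℕ)).comp (pb.basis.coord m)

/-- Unfolding `toPoly`. [cite: BurgisserClausenShokrollahi1997, Cor. (17.2) (proof)] -/
theorem toPoly_apply (pb : PowerBasis k K) (x : K) :
    toPoly pb x = ∑ m : Fin pb.dim, monomial (m : ℕ) (pb.basis.repr x m) := by
  simp [toPoly, LinearMap.sum_apply]

/-- `(toPoly x)(θ) = x`. [cite: BurgisserClausenShokrollahi1997, Cor. (17.2) (proof)] -/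
theorem aeval_toPoly (pb : PowerBasis k K) (x : K) : aeval pb.gen (toPoly pb x) = x := by
  rw [toPoly_apply, map_sum]
  simp_rw [aeval_monomial, ← Algebra.smul_def]
  conv_rhs => rw [← pb.basis.sum_repr x]
  simp [pb.coe_basis]

/-- `deg (toPoly x) ≤ n − 1`. [cite: BurgisserClausenShokrollahi1997, Cor. (17.2) (proof)] -/
theorem natDegree_toPoly_le (pb : PowerBasis k K) (x : K) :
    (toPoly pb x).natDegree ≤ pb.dim - 1 := by
  rw [toPoly_apply]
  exact natDegree_sum_le_of_forall_le _ _ fun m _ =>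
    (natDegree_monomial_le _).trans (by have := m.2; omega)

/-- The coefficients of `toPoly x` are the coordinates of `x`.
[cite: BurgisserClausenShokrollahi1997, Cor. (17.2) (proof)] -/
theorem coeff_toPoly (pb : PowerBasis k K) (x : K) (m : Fin pb.dim) :
    (toPoly pb x).coeff m = pb.basis.repr x m := by
  rw [toPoly_apply, finsetSum_coeff, Finset.sum_eq_single m]
  · exact coeff_monomial_same _ _
  · intro j _ hj
    rw [coeff_monomial, if_neg (fun h => hj (Fin.ext h))]
  · exact fun h => (h (Finset.mem_univ m)).elim

/-- **The polynomial identity behind (17.2)**: for `a, b` of degree `≤ n − 1` and `2n − 2` distinct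
nodes `αⱼ`, `a·b = ∑ⱼ a(αⱼ)b(αⱼ)·Lⱼ + a_{n−1}b_{n−1}·∏ⱼ(X − αⱼ)` (`Lⱼ` the Lagrange polynomials):
the difference `ab − a_{n−1}b_{n−1}∏(X − αⱼ)` has degree `< 2n − 2` and the right values at the
nodes. [cite: BurgisserClausenShokrollahi1997, Cor. (17.2) (proof)] -/
theorem mul_eq_sum_lagrange_add_nodal {n N : ℕ} (hN : N = (n - 1) + (n - 1)) {α : Fin N → k}
    (hα : Function.Injective α) {a b : k[X]} (ha : a.natDegree ≤ n - 1) (hb : b.natDegree ≤ n - 1) :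
    a * b = (∑ j, C (a.eval (α j) * b.eval (α j)) * Lagrange.basis Finset.univ α j) +
      C (a.coeff (n - 1) * b.coeff (n - 1)) * Lagrange.nodal Finset.univ α := by
  set r := a.coeff (n - 1) * b.coeff (n - 1) with hr
  have hvs : Set.InjOn α (Finset.univ : Finset (Fin N)) := hα.injOn
  have hcard : (Finset.univ : Finset (Fin N)).card = N := Finset.card_fin N
  -- the corrected product has small degree
  have hdeg : (a * b - C r * Lagrange.nodal Finset.univ α).degree <
      ((Finset.univ : Finset (Fin N)).card : WithBot ℕ) := by
    rw [hcard, degree_lt_iff_coeff_zero]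
    intro m hm
    rw [coeff_sub, coeff_C_mul]
    rcases hm.lt_or_eq with hlt | heq
    · rw [coeff_eq_zero_of_natDegree_lt ((natDegree_mul_le).trans_lt (by omega)),
        coeff_eq_zero_of_natDegree_lt (by rw [Lagrange.natDegree_nodal, hcard]; exact hlt),
        mul_zero, sub_zero]
    · subst heq
      have h1 : (a * b).coeff N = a.coeff (n - 1) * b.coeff (n - 1) := by
        rw [hN]; exact coeff_mul_add_eq_of_natDegree_le ha hb
      have hmonic : (Lagrange.nodal (Finset.univ : Finset (Fin N)) α).coeff N = 1 := by
        have h := (Lagrange.nodal_monic (s := (Finset.univ : Finset (Fin N))) (v := α)).coeff_natDegree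
        rwa [Lagrange.natDegree_nodal, hcard] at h
      rw [h1, hmonic, mul_one, hr, sub_self]
  have heval : ∀ j ∈ (Finset.univ : Finset (Fin N)),
      (a * b - C r * Lagrange.nodal Finset.univ α).eval (α j) = a.eval (α j) * b.eval (α j) := by
    intro j hj
    rw [eval_sub, eval_mul, eval_mul, eval_C, Lagrange.eval_nodal_at_node hj, mul_zero, sub_zero]
  have key := Lagrange.eq_interpolate_of_eval_eq (fun j => a.eval (α j) * b.eval (α j)) hvs hdeg heval
  rw [Lagrange.interpolate_apply] at key
  rw [← key, sub_add_cancel]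

variable (pb : PowerBasis k K) {N : ℕ} (α : Fin N → k)

/-- The index of the leading-coefficient slot `n − 1` (plumbing).
[cite: BurgisserClausenShokrollahi1997, Cor. (17.2) (proof)] -/
private def top (pb : PowerBasis k K) : Fin pb.dim := ⟨pb.dim - 1, by have := pb.dim_pos; omega⟩

/-- `coeff_toPoly` at the top slot (plumbing). [cite: BurgisserClausenShokrollahi1997, Cor. (17.2) (proof)] -/
private theorem coeff_toPoly_top (x : K) :
    (toPoly pb x).coeff (pb.dim - 1) = pb.basis.repr x (top pb) :=
  coeff_toPoly pb x (top pb)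

/-- **The printed computation of (17.2)**: the `2n − 1` bilinear products `a(αⱼ)·b(αⱼ)`
(`j < 2n − 2`) and `a_{n−1}·b_{n−1}`, with outputs `Lⱼ(θ)` and `∏ⱼ(θ − αⱼ)`, compute the
multiplication of `K = k(θ)`. [cite: BurgisserClausenShokrollahi1997, Cor. (17.2)] -/
def bilinComp (hN : N = (pb.dim - 1) + (pb.dim - 1)) (hα : Function.Injective α) :
    BilinComp (LinearMap.mul k K) (Option (Fin N)) where
  f o := o.elim (pb.basis.coord (top pb)) fun j => (leval (α j)).comp (toPoly pb)
  g o := o.elim (pb.basis.coord (top pb)) fun j => (leval (α j)).comp (toPoly pb)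
  w o := o.elim (aeval pb.gen (Lagrange.nodal Finset.univ α))
    fun j => aeval pb.gen (Lagrange.basis Finset.univ α j)
  map_eq_sum x y := by
    have hL : x * y = aeval pb.gen (toPoly pb x * toPoly pb y) := by
      rw [map_mul, aeval_toPoly, aeval_toPoly]
    rw [LinearMap.mul_apply', hL, mul_eq_sum_lagrange_add_nodal hN hα (natDegree_toPoly_le pb x)
      (natDegree_toPoly_le pb y), map_add, map_sum, Fintype.sum_option, add_comm]
    simp_rw [← Polynomial.smul_eq_C_mul, map_smul]
    congr 1
    simp only [Option.elim_none, Basis.coord_apply]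
    rw [coeff_toPoly_top, coeff_toPoly_top]

/-- The length of the printed computation: `|Option (Fin (2n−2))| = 2n − 1`.
[cite: BurgisserClausenShokrollahi1997, Cor. (17.2)] -/
theorem card_option_fin (n : ℕ) (hn : 0 < n) :
    Fintype.card (Option (Fin ((n - 1) + (n - 1)))) = 2 * n - 1 := by
  rw [Fintype.card_option, Fintype.card_fin]; omega

/-- **(17.1)/(17.7) for `K`: every bilinear computation of the multiplication of `K` has length
`≥ 2n − 1`** (a bilinear computation is a quadratic one, `BilinComp.toQuadComp`, and (17.7)).
[cite: BurgisserClausenShokrollahi1997, Prop. (17.1)] -/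
theorem card_ge {ι : Type*} [Fintype ι] (β : BilinComp (LinearMap.mul k K) ι) :
    2 * pb.dim - 1 ≤ Fintype.card ι := by
  haveI : FiniteDimensional k K := pb.finite
  have h := β.toQuadComp.card_ge_divisionAlgebra
  rwa [pb.finrank] at h

/-- **`L(K) = 2n − 1`** in the quadratic model as well ((17.7) for `≥`; the printed bilinear
computation, read as a quadratic one, for `≤`). [cite: BurgisserClausenShokrollahi1997, Cor. (17.2) and Prop. (17.7)] -/
theorem mulComplexity_eq (hα : ∃ α : Fin ((pb.dim - 1) + (pb.dim - 1)) → k, Function.Injective α) :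
    mulComplexity (LinearMap.mul k K) = 2 * pb.dim - 1 := by
  haveI : FiniteDimensional k K := pb.finite
  obtain ⟨α, hα⟩ := hα
  refine le_antisymm ?_ ?_
  · have h := mulComplexity_le_card (bilinComp pb α rfl hα).toQuadComp
    rwa [card_option_fin _ pb.dim_pos] at h
  · have h := fiducciaZalcstein_le_mulComplexity k K
    rwa [pb.finrank] at h

end SimpleExtension

/-- **BCS (17.2): `R(K) = 2n − 1`** for a simple extension `K = k(θ) ⊇ k` of degree `n` when
`|k| ≥ 2n − 2`, stated with the tree's bilinear computations: there is a bilinear computation of the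
multiplication of `K` of length `2n − 1`, and every bilinear computation has length `≥ 2n − 1`.
[cite: BurgisserClausenShokrollahi1997, Cor. (17.2)] -/
theorem BCS1997_cor_17_2 (k : Type*) [Field k] (K : Type*) [Field K] [Algebra k K]
    (pb : PowerBasis k K) (hk : ∃ α : Fin ((pb.dim - 1) + (pb.dim - 1)) → k, Function.Injective α) :
    (∃ (ι : Type) (_ : Fintype ι) (_ : BilinComp (LinearMap.mul k K) ι),
        Fintype.card ι = 2 * pb.dim - 1) ∧
      ∀ (ι : Type*) [Fintype ι] (β : BilinComp (LinearMap.mul k K) ι), 2 * pb.dim - 1 ≤ Fintype.card ι := by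
  obtain ⟨α, hα⟩ := hk
  exact ⟨⟨Option (Fin ((pb.dim - 1) + (pb.dim - 1))), inferInstance, SimpleExtension.bilinComp pb α rfl hα,
    SimpleExtension.card_option_fin _ pb.dim_pos⟩, fun ι _ β => SimpleExtension.card_ge pb β⟩

/-! ## Two printed instances: finite fields, and `ℂ ⊇ ℝ` -/

section Instances

/-- **(17.2) for finite separable extensions without naming the generator**: if `K ⊇ k` is a finite
separable extension of degree `n` (hence simple, by the primitive element theorem) and `k` has at least
`2n − 2` elements in the sense of an injection `Fin (2n − 2) ↪ k`, then `L(K) = 2n − 1`.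
[cite: BurgisserClausenShokrollahi1997, Cor. (17.2)] -/
theorem SimpleExtension.mulComplexity_eq_of_separable (k : Type*) [Field k] (K : Type*) [Field K]
    [Algebra k K] [FiniteDimensional k K] [Algebra.IsSeparable k K]
    (hk : ∃ α : Fin ((finrank k K - 1) + (finrank k K - 1)) → k, Function.Injective α) :
    mulComplexity (LinearMap.mul k K) = 2 * finrank k K - 1 := by
  let pb := Field.powerBasisOfFiniteOfSeparable k K
  have hdim : pb.dim = finrank k K := pb.finrank.symm
  have h := SimpleExtension.mulComplexity_eq pb (by rw [hdim]; exact hk)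
  rwa [hdim] at h

/-- **(17.2) over a finite field**: for a finite field `k` with `q` elements and an extension `K` of
degree `n` with `2n − 2 ≤ q`, `L(K) = 2n − 1` (e.g. `𝔽_{qⁿ} ⊇ 𝔽_q`).
[cite: BurgisserClausenShokrollahi1997, Cor. (17.2)] -/
theorem SimpleExtension.mulComplexity_eq_of_finite (k : Type*) [Field k] [Fintype k] (K : Type*)
    [Field K] [Algebra k K] [FiniteDimensional k K]
    (hq : 2 * finrank k K - 2 ≤ Fintype.card k) :
    mulComplexity (LinearMap.mul k K) = 2 * finrank k K - 1 := by
  haveI : Finite k := inferInstance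
  haveI : PerfectField k := PerfectField.ofFinite
  refine SimpleExtension.mulComplexity_eq_of_separable k K ⟨fun i => (Fintype.equivFin k).symm
    (Fin.castLE (by omega) i), fun i j hij => ?_⟩
  have := (Fintype.equivFin k).symm.injective hij
  exact Fin.castLE_injective _ this

/-- **(17.2) for `ℂ = ℝ(i)`, `n = 2`: `L_ℝ(ℂ) = 3`** — three real multiplications are necessary and
sufficient for one complex multiplication, also among quadratic (commutative) algorithms.
[cite: BurgisserClausenShokrollahi1997, Cor. (17.2)] -/
theorem mulComplexity_complex_real : mulComplexity (LinearMap.mul ℝ ℂ) = 3 := by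
  have h := SimpleExtension.mulComplexity_eq_of_separable ℝ ℂ
    ⟨fun i => ((i : ℕ) : ℝ), fun i j hij => Fin.ext (Nat.cast_injective (R := ℝ) hij)⟩
  rw [Complex.finrank_real_complex] at h
  exact h

end Instances

end Literature.Computability.AlgebraicComplexity
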